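import Summits.AnomalousDissipation.AnomalousDissipation.Theorems.SawtoothPulseCascadeK1LocalisedCascadeBlockJunk

/-!
# K1loc — helper: THE JUNK OF A FAMILY OF GEOMETRIC FIBRE BLOCKS, OSCILLATORY GRADE (closed form)

Helper file of the prover lane on the crux `K1LocalisedCascade` (stmt-AnomalousDissipation-19491), route `SawtoothPulseCascade`
(S-B/S-C assembly seat; the LEDGER ASSEMBLY, arithmetic layer, Osc grade; companion of `…BlockJunk`).  The oscillatory
multi-block class steps (`…RatioBlocksOsc`, `…StripBlocksOsc`) ask, on block `m`, for a depth `d₀^m` with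
`1/(2πD_m) + 4Mδ/(πD_m d₀^m) ≤ A_m d₀^m` and `Mδ < πN d₀^m`, and for a rounding allowance
`ε₀^m ≥ A_m·2π(Λ_{m+1}G)e^{−M²/2}/(2N) + 2N/(πD_m)`.  The canonical oscillatory depth
  `d₀^m = 1/(2πA_mD_m) + √(4Mδ/(πA_mD_m)) + Mδ/(πN)`
satisfies both (`oscDepth_hAd`, `oscDepth_hMd`), and with block constants `0 ≤ r_m ≤ r*`, `1 ≤ A_m ≤ A*`, `D_m ≥ D₀·2^m`
and `ε₀^m ≤ e₀·2^{m+1} + b₀·2^{−m}` the junk energy is at most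
  **`3·r*²·((4/3)(e₀2^{M_b})² + (4/3)b₀² + 4·N·A*·2/(π·D₀) + M_b·(8N·A*²·√(4Mδ/(πD₀)) + 8A*²Mδ/π))`** (`blockJunk_osc_sum_le`):
the kernel part `4NA*/(πD₀)·Σ2^{−m}` is geometric over the blocks, the corner parts grow linearly with the number of blocks.
Pure real arithmetic; no definitions; no statement about the crux. [cite: Grafakos2014, Prop. 3.2.7 (3)] [problem: turb]
-/

-- `Summit.<Summit>.<Problem>`: single-conjunct summit, the duplicate namespace segment is deliberate.
set_option linter.dupNamespace false

noncomputable section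

namespace Summit.AnomalousDissipation.AnomalousDissipation.Theorems.SawtoothPulseCascade.K1Window

open Finset Real
open Summit.AnomalousDissipation.AnomalousDissipation.Theorems.SawtoothPulseCascade.K1Ledger.From

/-- **The canonical oscillatory depth satisfies the oscillatory depth hypothesis**: with
`d₀ = 1/(2πAD) + √(4Mδ/(πAD)) + Mδ/(πN)` (`A, D, N > 0`, `M δ ≥ 0`), `1/(2πD) + 4Mδ/(πD d₀) ≤ A d₀`. [folklore] -/
theorem oscDepth_hAd {A D N M δ : ℝ} (hA : 0 < A) (hD : 0 < D) (hN : 0 < N) (hMδ : 0 ≤ M * δ) :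
    1 / (2 * π * D) + 4 * M * δ / (π * D * (1 / (2 * π * A * D) + Real.sqrt (4 * (M * δ) / (π * A * D)) + M * δ / (π * N))) ≤
      A * (1 / (2 * π * A * D) + Real.sqrt (4 * (M * δ) / (π * A * D)) + M * δ / (π * N)) := by
  have hπ := Real.pi_pos
  set y : ℝ := Real.sqrt (4 * (M * δ) / (π * A * D)) with hy
  have hy0 : 0 ≤ y := Real.sqrt_nonneg _
  have hx0 : 0 < 1 / (2 * π * A * D) := by positivity
  have hz0 : 0 ≤ M * δ / (π * N) := by positivity
  set d : ℝ := 1 / (2 * π * A * D) + y + M * δ / (π * N) with hd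
  have hd0 : 0 < d := by positivity
  have hyd : y ≤ d := by linarith
  have hy2 : y ^ 2 = 4 * (M * δ) / (π * A * D) := Real.sq_sqrt (by positivity)
  have key : 4 * M * δ / (π * D * d) ≤ A * y := by
    rw [div_le_iff₀ (by positivity)]
    have h1 : A * y * (π * D * y) = 4 * M * δ := by
      have e : A * y * (π * D * y) = π * A * D * y ^ 2 := by ring
      rw [e, hy2]; field_simp
    have h2 : A * y * (π * D * y) ≤ A * y * (π * D * d) :=
      mul_le_mul_of_nonneg_left (mul_le_mul_of_nonneg_left hyd (by positivity)) (by positivity)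
    linarith
  have hAd : A * d = 1 / (2 * π * D) + A * y + A * (M * δ / (π * N)) := by
    rw [hd]; field_simp
  have hAz : 0 ≤ A * (M * δ / (π * N)) := by positivity
  rw [hAd]
  linarith

/-- **The canonical oscillatory depth dominates the phase-blur scale**: `Mδ < πN·d₀` for
`d₀ = 1/(2πAD) + √(4Mδ/(πAD)) + Mδ/(πN)` (`A, D, N > 0`). [folklore] -/
theorem oscDepth_hMd {A D N M δ : ℝ} (hA : 0 < A) (hD : 0 < D) (hN : 0 < N) :
    M * δ < π * N * (1 / (2 * π * A * D) + Real.sqrt (4 * (M * δ) / (π * A * D)) + M * δ / (π * N)) := by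
  have hπ := Real.pi_pos
  have hy0 : 0 ≤ Real.sqrt (4 * (M * δ) / (π * A * D)) := Real.sqrt_nonneg _
  have hx0 : 0 < π * N * (1 / (2 * π * A * D)) := by positivity
  have hz : π * N * (M * δ / (π * N)) = M * δ := by field_simp
  nlinarith [mul_nonneg (by positivity : (0 : ℝ) ≤ π * N) hy0]

/-- **One block's oscillatory junk energy**: with `d₀ = 1/(2πAD) + √(4Mδ/(πAD)) + Mδ/(πN)`, `1 ≤ A ≤ A*`, `0 < D₀ ≤ D`,
`(A·√(2N·4d₀))² ≤ 4N·A*/(πD)·… ` precisely `≤ 4·N·A*/(π·D) + 8·N·A*²·√(4Mδ/(πD₀)) + 8·A*²·Mδ/π`. [folklore] -/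
theorem block_oscDepth_sq_le {A D D₀ N Mδ As : ℝ} (hA1 : 1 ≤ A) (hA : A ≤ As) (hD₀ : 0 < D₀) (hD : D₀ ≤ D) (hN : 0 < N)
    (hMδ : 0 ≤ Mδ) :
    (A * Real.sqrt (2 * N * (4 * (1 / (2 * π * A * D) + Real.sqrt (4 * Mδ / (π * A * D)) + Mδ / (π * N))))) ^ 2 ≤
      4 * N * As / (π * D) + 8 * N * As ^ 2 * Real.sqrt (4 * Mδ / (π * D₀)) + 8 * As ^ 2 * Mδ / π := by
  have hπ := Real.pi_pos
  have hA0 : 0 < A := lt_of_lt_of_le one_pos hA1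
  have hDpos : 0 < D := lt_of_lt_of_le hD₀ hD
  have hAs : A ^ 2 ≤ As ^ 2 := pow_le_pow_left₀ hA0.le hA 2
  have hAs0 : 0 ≤ As := hA0.le.trans hA
  set y : ℝ := Real.sqrt (4 * Mδ / (π * A * D)) with hy
  have hy0 : 0 ≤ y := Real.sqrt_nonneg _
  have hyle : y ≤ Real.sqrt (4 * Mδ / (π * D₀)) := by
    refine Real.sqrt_le_sqrt (div_le_div_of_nonneg_left (by positivity) (by positivity) ?_)
    -- π D₀ ≤ π A D
    have : D₀ ≤ A * D := by nlinarith
    nlinarith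
  have hin : 0 ≤ 2 * N * (4 * (1 / (2 * π * A * D) + y + Mδ / (π * N))) := by positivity
  rw [mul_pow, Real.sq_sqrt hin]
  -- A²·8N·(x + y + z) = 4NA/(πD) + 8NA²y + 8A²Mδ/π
  have e : A ^ 2 * (2 * N * (4 * (1 / (2 * π * A * D) + y + Mδ / (π * N)))) =
      4 * N * A / (π * D) + 8 * N * A ^ 2 * y + 8 * A ^ 2 * Mδ / π := by
    field_simp
    ring
  rw [e]
  have h1 : 4 * N * A / (π * D) ≤ 4 * N * As / (π * D) :=
    div_le_div_of_nonneg_right (by nlinarith [hN.le]) (by positivity)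
  have h2 : 8 * N * A ^ 2 * y ≤ 8 * N * As ^ 2 * Real.sqrt (4 * Mδ / (π * D₀)) :=
    mul_le_mul (by nlinarith [hN.le]) hyle hy0 (by positivity)
  have h3 : 8 * A ^ 2 * Mδ / π ≤ 8 * As ^ 2 * Mδ / π :=
    div_le_div_of_nonneg_right (by nlinarith) hπ.le
  linarith

/-- **THE OSCILLATORY JUNK OF A FAMILY OF GEOMETRIC BLOCKS** (see the file header): block constants `0 ≤ r_m ≤ r*`,
`1 ≤ A_m ≤ A*`, denominators `D_m ≥ D₀2^m` (`D₀ > 0`), the canonical oscillatory depth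
`d₀^m = 1/(2πA_mD_m) + √(4Mδ/(πA_mD_m)) + Mδ/(πN)` (`N > 0`, `Mδ ≥ 0`) and rounding allowances
`0 ≤ ε₀^m ≤ e₀·2^{m+1} + b₀·(1/2)^m` (`e₀, b₀ ≥ 0`):
`Σ_{m<M_b} (r_m(ε₀^m + A_m√(2N·4d₀^m)))² ≤ 3r*²·((4/3)(e₀2^{M_b})² + (4/3)b₀² + 8·N·A*/(π·D₀) + M_b·(8N·A*²·√(4Mδ/(πD₀)) + 8A*²Mδ/π))`.
[folklore] -/
theorem blockJunk_osc_sum_le {r A D ε₀ : ℕ → ℝ} {rs As D₀ e₀ b₀ N Mδ : ℝ} (hN : 0 < N) (hMδ : 0 ≤ Mδ) (hD₀ : 0 < D₀)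
    (hr0 : ∀ m, 0 ≤ r m) (hr : ∀ m, r m ≤ rs) (hA1 : ∀ m, 1 ≤ A m) (hA : ∀ m, A m ≤ As)
    (hD : ∀ m, D₀ * 2 ^ m ≤ D m) (hε0 : ∀ m, 0 ≤ ε₀ m) (he₀ : 0 ≤ e₀) (hb₀ : 0 ≤ b₀)
    (hε : ∀ m, ε₀ m ≤ e₀ * 2 ^ (m + 1) + b₀ * (1 / 2) ^ m) (Mb : ℕ) :
    ∑ m ∈ range Mb, (r m * (ε₀ m + A m * Real.sqrt (2 * N * (4 * (1 / (2 * π * A m * D m) +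
        Real.sqrt (4 * Mδ / (π * A m * D m)) + Mδ / (π * N)))))) ^ 2 ≤
      3 * rs ^ 2 * (4 / 3 * (e₀ * 2 ^ Mb) ^ 2 + 4 / 3 * b₀ ^ 2 + 8 * N * As / (π * D₀) +
        Mb * (8 * N * As ^ 2 * Real.sqrt (4 * Mδ / (π * D₀)) + 8 * As ^ 2 * Mδ / π)) := by
  have hπ := Real.pi_pos
  have hA0 : ∀ m, 0 < A m := fun m => lt_of_lt_of_le one_pos (hA1 m)
  have hAs : 0 ≤ As := (hA0 0).le.trans (hA 0)
  have hrs : 0 ≤ rs := (hr0 0).trans (hr 0)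
  set C : ℝ := 8 * N * As ^ 2 * Real.sqrt (4 * Mδ / (π * D₀)) + 8 * As ^ 2 * Mδ / π with hC
  have hC0 : 0 ≤ C := by positivity
  -- per block
  have hblock : ∀ m, (r m * (ε₀ m + A m * Real.sqrt (2 * N * (4 * (1 / (2 * π * A m * D m) +
      Real.sqrt (4 * Mδ / (π * A m * D m)) + Mδ / (π * N)))))) ^ 2 ≤
      3 * rs ^ 2 * ((e₀ * 2 ^ (m + 1)) ^ 2 + b₀ ^ 2 * (1 / 4) ^ m + (4 * N * As / (π * D₀) * (1 / 2) ^ m + C)) := by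
    intro m
    have hDm : 0 < D₀ * 2 ^ m := by positivity
    have hs2 := block_oscDepth_sq_le (N := N) (Mδ := Mδ) (hA1 m) (hA m) hDm (hD m) hN hMδ
    set s := A m * Real.sqrt (2 * N * (4 * (1 / (2 * π * A m * D m) + Real.sqrt (4 * Mδ / (π * A m * D m)) +
      Mδ / (π * N)))) with hs
    have hs0 : 0 ≤ s := mul_nonneg (hA0 m).le (Real.sqrt_nonneg _)
    -- the uniform block bound of `s²`
    have hD0le : Real.sqrt (4 * Mδ / (π * (D₀ * 2 ^ m))) ≤ Real.sqrt (4 * Mδ / (π * D₀)) := by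
      refine Real.sqrt_le_sqrt (div_le_div_of_nonneg_left (by positivity) (by positivity) ?_)
      have h1 : (1 : ℝ) ≤ 2 ^ m := one_le_pow₀ (by norm_num)
      have h2 := mul_le_mul_of_nonneg_left h1 (by positivity : (0 : ℝ) ≤ π * D₀)
      linarith
    have hs2' : s ^ 2 ≤ 4 * N * As / (π * D₀) * (1 / 2) ^ m + C := by
      have e1 : 4 * N * As / (π * (D₀ * 2 ^ m)) = 4 * N * As / (π * D₀) * (1 / 2) ^ m := by
        rw [one_div_pow]; field_simp
      have h2 : 8 * N * As ^ 2 * Real.sqrt (4 * Mδ / (π * (D₀ * 2 ^ m))) ≤ 8 * N * As ^ 2 * Real.sqrt (4 * Mδ / (π * D₀)) :=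
        mul_le_mul_of_nonneg_left hD0le (by positivity)
      have h1 : 4 * N * As / (π * D m) ≤ 4 * N * As / (π * (D₀ * 2 ^ m)) :=
        div_le_div_of_nonneg_left (by positivity) (by positivity) (mul_le_mul_of_nonneg_left (hD m) hπ.le)
      rw [hC, ← e1]
      linarith
    -- `ε₀ ≤ a₁ + a₂`, then `(a₁ + a₂ + s)² ≤ 3(a₁² + a₂² + s²)`
    set a₁ : ℝ := e₀ * 2 ^ (m + 1) with ha₁
    set a₂ : ℝ := b₀ * (1 / 2) ^ m with ha₂
    have ha₁0 : 0 ≤ a₁ := by positivity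
    have ha₂0 : 0 ≤ a₂ := by positivity
    have hin : 0 ≤ ε₀ m + s := add_nonneg (hε0 m) hs0
    have hle : r m * (ε₀ m + s) ≤ rs * (a₁ + a₂ + s) := by
      calc r m * (ε₀ m + s) ≤ rs * (ε₀ m + s) := mul_le_mul_of_nonneg_right (hr m) hin
        _ ≤ rs * (a₁ + a₂ + s) := mul_le_mul_of_nonneg_left (by linarith [hε m]) hrs
    have hl0 : 0 ≤ r m * (ε₀ m + s) := mul_nonneg (hr0 m) hin
    have ea₂ : a₂ ^ 2 = b₀ ^ 2 * (1 / 4) ^ m := by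
      rw [ha₂, mul_pow, ← pow_mul, show ((1 : ℝ) / 2) ^ (m * 2) = (1 / 4) ^ m by rw [mul_comm, pow_mul]; norm_num]
    calc (r m * (ε₀ m + s)) ^ 2 ≤ (rs * (a₁ + a₂ + s)) ^ 2 := pow_le_pow_left₀ hl0 hle 2
      _ = rs ^ 2 * (a₁ + a₂ + s) ^ 2 := by ring
      _ ≤ rs ^ 2 * (3 * (a₁ ^ 2 + a₂ ^ 2 + s ^ 2)) :=
          mul_le_mul_of_nonneg_left
            (by nlinarith [sq_nonneg (a₁ - a₂), sq_nonneg (a₂ - s), sq_nonneg (a₁ - s)]) (sq_nonneg _)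
      _ ≤ 3 * rs ^ 2 * (a₁ ^ 2 + b₀ ^ 2 * (1 / 4) ^ m + (4 * N * As / (π * D₀) * (1 / 2) ^ m + C)) := by
          rw [← ea₂]
          have h3 : 0 ≤ 3 * rs ^ 2 := by positivity
          nlinarith
  -- sum over the blocks
  have hq : ∑ m ∈ range Mb, ((1 : ℝ) / 4) ^ m ≤ 4 / 3 := by
    have hg : ∑ m ∈ range Mb, ((1 : ℝ) / 4) ^ m = (((1 : ℝ) / 4) ^ Mb - 1) / (1 / 4 - 1) := geom_sum_eq (by norm_num) Mb
    rw [hg]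
    have h0 : (0 : ℝ) ≤ ((1 : ℝ) / 4) ^ Mb := by positivity
    have e : (((1 : ℝ) / 4) ^ Mb - 1) / (1 / 4 - 1) = 4 / 3 * (1 - ((1 : ℝ) / 4) ^ Mb) := by field_simp; ring
    rw [e]
    nlinarith
  calc ∑ m ∈ range Mb, (r m * (ε₀ m + A m * Real.sqrt (2 * N * (4 * (1 / (2 * π * A m * D m) +
        Real.sqrt (4 * Mδ / (π * A m * D m)) + Mδ / (π * N)))))) ^ 2
      ≤ ∑ m ∈ range Mb, 3 * rs ^ 2 * ((e₀ * 2 ^ (m + 1)) ^ 2 + b₀ ^ 2 * (1 / 4) ^ m +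
          (4 * N * As / (π * D₀) * (1 / 2) ^ m + C)) := Finset.sum_le_sum fun m _ => hblock m
    _ = 3 * rs ^ 2 * (e₀ ^ 2 * ∑ m ∈ range Mb, ((2 : ℝ) ^ (m + 1)) ^ 2 + b₀ ^ 2 * ∑ m ∈ range Mb, ((1 : ℝ) / 4) ^ m +
          (4 * N * As / (π * D₀) * ∑ m ∈ range Mb, ((1 : ℝ) / 2) ^ m + Mb * C)) := by
        rw [← Finset.mul_sum, Finset.sum_add_distrib, Finset.sum_add_distrib, Finset.sum_add_distrib, Finset.mul_sum,
          Finset.mul_sum, Finset.mul_sum, Finset.sum_const, Finset.card_range, nsmul_eq_mul]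
        congr 1
        refine congrArg₂ _ (congrArg₂ _ (Finset.sum_congr rfl fun m _ => by ring) rfl) rfl
    _ ≤ 3 * rs ^ 2 * (4 / 3 * (e₀ * 2 ^ Mb) ^ 2 + 4 / 3 * b₀ ^ 2 + 8 * N * As / (π * D₀) + Mb * C) := by
        refine mul_le_mul_of_nonneg_left ?_ (by positivity)
        have hS1 : e₀ ^ 2 * ∑ m ∈ range Mb, ((2 : ℝ) ^ (m + 1)) ^ 2 ≤ 4 / 3 * (e₀ * 2 ^ Mb) ^ 2 := by
          calc e₀ ^ 2 * ∑ m ∈ range Mb, ((2 : ℝ) ^ (m + 1)) ^ 2 ≤ e₀ ^ 2 * (4 / 3 * ((2 : ℝ) ^ Mb) ^ 2) :=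
              mul_le_mul_of_nonneg_left (sum_range_sq_two_pow_succ_le Mb) (sq_nonneg _)
            _ = 4 / 3 * (e₀ * 2 ^ Mb) ^ 2 := by ring
        have hS2 : b₀ ^ 2 * ∑ m ∈ range Mb, ((1 : ℝ) / 4) ^ m ≤ 4 / 3 * b₀ ^ 2 := by
          nlinarith [hq, sq_nonneg b₀]
        have hS3 : 4 * N * As / (π * D₀) * ∑ m ∈ range Mb, ((1 : ℝ) / 2) ^ m ≤ 8 * N * As / (π * D₀) := by
          have := sum_range_half_pow_le Mb
          have h0 : 0 ≤ 4 * N * As / (π * D₀) := by positivity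
          have e : 8 * N * As / (π * D₀) = 4 * N * As / (π * D₀) * 2 := by ring
          rw [e]; exact mul_le_mul_of_nonneg_left this h0
        linarith

end Summit.AnomalousDissipation.AnomalousDissipation.Theorems.SawtoothPulseCascade.K1Window
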